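import Literature.Geometry.Riemannian.ExpMapEnergyTaylor
import HarnessLib

/-!
# The energy density of an arbitrary smooth variation: O'Neill's Lemma 10.38 and a pointwise
# second-order Taylor bound

`ExpMapSecondVariation.lean` / `ExpMapEnergyTaylor.lean` treat the variations
`x(t, σ) = exp_{γ(t)}(σ X(t))`, all of whose `σ`-curves are geodesics, so that the transverse
acceleration `A = D_σ ∂_σ x` vanishes. For variations with a constrained end (the first transverse
curve lying in a submanifold, O'Neill 1983, Ch. 10, pp. 293–294; used for Hawking's singularity
theorem through Prop. 10.37) the acceleration term is needed. For a smooth pseudo-Riemannian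
metric `g` of any signature (Levi-Civita connection `∇`, curvature `R`) and a `C^∞` two-parameter
map `x : ℝ × ℝ → M` with `T = ∂_t x`, `S = ∂_σ x` we PROVE

* `hasDerivAt_val_covariantDerivAlong_velocity_acc` — **O'Neill 1983, Ch. 10, Lemma 10.38**
  (second formula, at every `(t, σ)` and not only at `σ = 0`):
  `∂_σ g(D_t S, T) = g(D_t D_σ S, T) + g(R(S, T) S, T) + g(D_t S, D_t S)`
  (O'Neill: `½ f_vv = ⟨x_vu, x_vu⟩ − ⟨R(x_u, x_v) x_u, x_v⟩ + ⟨x_vvu, x_u⟩` with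
  `R_{XY} = −[D_X, D_Y] + D_{[X,Y]}`; in the tree's convention `D_t D_σ − D_σ D_t = R(x_t, x_σ)`,
  `covariantDerivAlong_covariantDerivAlong_sub_eq_curvature`, and `⟨R(S,T)S, T⟩` carries O'Neill's
  `−⟨R_{x_u x_v} x_u, x_v⟩`); together with `hasDerivAt_half_val_velocity`
  (`∂_σ ½ g(T, T) = g(D_t S, T)`, first formula of the Lemma, already in the tree);
* `val_velocity_le_taylor` — **the pointwise second-order Taylor bound with uniform error**: on a
  compact parameter rectangle, for every `ε > 0` there is `δ > 0` such that for `σ ∈ [0, δ]` and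
  `t ∈ [a, b]`,
  `g(T,T)(t, σ) ≤ g(T,T)(t, 0) + 2σ g(D_t S, T)(t, 0) + σ² (h(t, 0) + ε)`,
  `h = g(D_t D_σ S, T) + g(R(S,T)S,T) + |D_t S|²`, together with the joint continuity of `h`
  (it is a partial derivative of the `C^∞` function `g(D_t S, T)`). This is the analysis behind
  the second variation formula (O'Neill 1983, Ch. 10, Thm. 10.4 / Prop. 10.39) without
  differentiating under the integral sign, exactly as in `integral_energy_le_taylor`, for general
  variations: for a Lorentzian metric and a timelike `t`-curve it bounds `−g(T,T)` from BELOW, which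
  is what the maximality argument of Hawking's theorem consumes.

Everything is proved; no definitions and no named facts are introduced (D-0026).

## References

* B. O'Neill, *Semi-Riemannian geometry with applications to relativity*, Academic Press 1983,
  Ch. 10, Lemma 10.38 and Prop. 10.39 (pp. 288–289), Thm. 10.4 (p. 266); Ch. 4, Prop. 44.
  [ONeill1983]
* J. M. Lee, *Introduction to Riemannian Manifolds*, 2nd ed. (2018), Thm. 6.3, Thm. 10.22.
  [LeeRiemannianManifolds2018]
-/

noncomputable section

open Bundle Set Filter Function
open scoped Manifold ContDiff Topology

namespace Literature.Geometry.Riemannian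

open Literature.Geometry.Lorentzian
open Literature.Geometry.Lorentzian.PseudoRiemannianMetric

variable {E : Type*} [NormedAddCommGroup E] [NormedSpace ℝ E] {H : Type*} [TopologicalSpace H]
  {I : ModelWithCorners ℝ E H} {M : Type*} [TopologicalSpace M] [ChartedSpace H M]
  [IsManifold I ∞ M] {n : ℕ∞ω} [FiniteDimensional ℝ E] [CompleteSpace E]
  (g : PseudoRiemannianMetric I n E (TangentSpace I : M → Type _)) [g.HasLeviCivita]

/-- **O'Neill's Lemma 10.38, second formula, for an arbitrary smooth variation**: for a `C^∞`
two-parameter map `x(t, σ)` and a smooth metric, with `T = ∂_t x`, `S = ∂_σ x`,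
`∂_σ g(D_t S, T) = g(D_t D_σ S, T) + g(R(S, T) S, T) + g(D_t S, D_t S)` at every `(t, σ)`
(metric compatibility `hasDerivAt_val_apply_along`; `D_σ T = D_t S`,
`covariantDerivAlong_velocity_comm`; `D_σ D_t S = D_t D_σ S − R(T, S) S`,
`covariantDerivAlong_covariantDerivAlong_sub_eq_curvature`). The term `g(D_t D_σ S, T)` is the
transverse-acceleration term `⟨A', α'⟩` of the second variation formula (it is absent for variations
through geodesics, `hasDerivAt_val_covariantDerivAlong_velocity`).
[cite: ONeill1983, Ch. 10, Lemma 10.38] -/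
theorem hasDerivAt_val_covariantDerivAlong_velocity_acc (hn : (∞ : ℕ∞ω) ≤ n) {x : ℝ → ℝ → M}
    (hx : ContMDiff (𝓘(ℝ, ℝ).prod 𝓘(ℝ, ℝ)) I ∞ (uncurry x)) (t σ : ℝ) :
    HasDerivAt (fun σ' ↦ g.val (x t σ') (covariantDerivAlong g.leviCivita (fun t' ↦ x t' σ')
        (fun t' ↦ velocity I (x t') σ') t) (velocity I (fun t' ↦ x t' σ') t))
      (g.val (x t σ) (covariantDerivAlong g.leviCivita (fun t' ↦ x t' σ)
          (fun t' ↦ covariantDerivAlong g.leviCivita (x t') (fun s' ↦ velocity I (x t') s') σ) t)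
          (velocity I (fun t' ↦ x t' σ) t) +
        g.val (x t σ) (g.leviCivita.curvature (x t σ) (velocity I (x t) σ)
          (velocity I (fun t' ↦ x t' σ) t) (velocity I (x t) σ)) (velocity I (fun t' ↦ x t' σ) t) +
        g.val (x t σ) (covariantDerivAlong g.leviCivita (fun t' ↦ x t' σ)
          (fun t' ↦ velocity I (x t') σ) t)
          (covariantDerivAlong g.leviCivita (fun t' ↦ x t' σ) (fun t' ↦ velocity I (x t') σ) t)) σ := by
  haveI : Fact (1 ≤ n) := ⟨le_trans (by exact_mod_cast le_top) hn⟩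
  have hLC : g.IsLeviCivita g.leviCivita := isLeviCivita_leviCivita_holds (g := g)
  set cov := g.leviCivita with hcov
  have hcov1 : cov.IsLocallyContMDiff 1 :=
    g.isLocallyContMDiff_leviCivita_holds 1 (le_trans (by exact_mod_cast le_top) hn)
  have hcovI : cov.IsLocallyContMDiff ∞ :=
    g.isLocallyContMDiff_leviCivita_holds ⊤ (le_trans (by exact_mod_cast le_rfl) hn)
  have h2 : (2 : ℕ∞ω) ≤ ∞ := WithTop.coe_le_coe.2 le_top
  have hx2 : ∀ q : ℝ × ℝ, ContMDiffAt (𝓘(ℝ, ℝ).prod 𝓘(ℝ, ℝ)) I 2 (uncurry x) q :=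
    fun q ↦ (hx q).of_le h2
  have hswap : ContMDiff (𝓘(ℝ, ℝ).prod 𝓘(ℝ, ℝ)) (𝓘(ℝ, ℝ).prod 𝓘(ℝ, ℝ)) ∞
      (fun q : ℝ × ℝ ↦ ((q.2, q.1) : ℝ × ℝ)) := contMDiff_snd.prodMk contMDiff_fst
  have hx' : ContMDiff (𝓘(ℝ, ℝ).prod 𝓘(ℝ, ℝ)) I ∞ (uncurry fun s t ↦ x t s) := hx.comp hswap
  -- the field `S = x_σ` and its smooth lift
  have hS : ContMDiff (𝓘(ℝ, ℝ).prod 𝓘(ℝ, ℝ)) I.tangent ∞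
      (fun q : ℝ × ℝ ↦ (TotalSpace.mk' E (x q.1 q.2) (velocity I (x q.1) q.2) : TangentBundle I M)) :=
    (contMDiff_lift_velocity_uncurry_left hx').comp hswap
  -- the field `D_t S` and its smooth lift
  have hDtS : ContMDiff (𝓘(ℝ, ℝ).prod 𝓘(ℝ, ℝ)) I.tangent ∞
      (fun q : ℝ × ℝ ↦ (TotalSpace.mk' E (x q.1 q.2)
        (covariantDerivAlong cov (fun t' ↦ x t' q.2) (fun t' ↦ velocity I (x t') q.2) q.1) :
          TangentBundle I M)) :=
    contMDiff_lift_covariantDerivAlong_curry_left (cov := cov) hcovI (x := x)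
      (Z := fun t s ↦ velocity I (x t) s) hx hS
  -- the field `D_σ S` (transverse acceleration) and its smooth lift
  have hDσS : ContMDiff (𝓘(ℝ, ℝ).prod 𝓘(ℝ, ℝ)) I.tangent ∞
      (fun q : ℝ × ℝ ↦ (TotalSpace.mk' E (x q.1 q.2)
        (covariantDerivAlong cov (x q.1) (fun s' ↦ velocity I (x q.1) s') q.2) :
          TangentBundle I M)) :=
    contMDiff_lift_covariantDerivAlong_curry_right (cov := cov) hcovI (x := x)
      (Z := fun t s ↦ velocity I (x t) s) hx hS
  -- the field `D_t D_σ S` and its smooth lift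
  have hDtDσS : ContMDiff (𝓘(ℝ, ℝ).prod 𝓘(ℝ, ℝ)) I.tangent ∞
      (fun q : ℝ × ℝ ↦ (TotalSpace.mk' E (x q.1 q.2)
        (covariantDerivAlong cov (fun t' ↦ x t' q.2)
          (fun t' ↦ covariantDerivAlong cov (x t') (fun s' ↦ velocity I (x t') s') q.2) q.1) :
          TangentBundle I M)) :=
    contMDiff_lift_covariantDerivAlong_curry_left (cov := cov) hcovI (x := x)
      (Z := fun t s ↦ covariantDerivAlong cov (x t) (fun s' ↦ velocity I (x t) s') s) hx hDσS
  -- lifts along the `σ`-curve at `t`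
  have hline : ContMDiff 𝓘(ℝ, ℝ) (𝓘(ℝ, ℝ).prod 𝓘(ℝ, ℝ)) ∞ (fun σ' : ℝ ↦ ((t, σ') : ℝ × ℝ)) :=
    contMDiff_const.prodMk contMDiff_id
  have hV : MDifferentiableAt 𝓘(ℝ, ℝ) I.tangent
      (fun σ' ↦ (TotalSpace.mk' E (x t σ')
        (covariantDerivAlong cov (fun t' ↦ x t' σ') (fun t' ↦ velocity I (x t') σ') t) :
          TangentBundle I M)) σ :=
    ((hDtS.comp hline) σ).mdifferentiableAt (by simp)
  have hW : MDifferentiableAt 𝓘(ℝ, ℝ) I.tangent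
      (fun σ' ↦ (TotalSpace.mk' E (x t σ') (velocity I (fun t' ↦ x t' σ') t) : TangentBundle I M)) σ :=
    mdifferentiableAt_lift_velocity_curry_left (hx2 (t, σ))
  have hprod := g.hasDerivAt_val_apply_along hLC.2 hV hW
  -- `D_σ x_t = D_t x_σ`
  have hsymm := covariantDerivAlong_velocity_comm cov hLC.1 (hx2 (t, σ))
  -- `D_t (D_σ S) - D_σ (D_t S) = R(T, S) S`
  have hcurv := covariantDerivAlong_covariantDerivAlong_sub_eq_curvature (cov := cov) hcov1
    (x := x) (Z := fun t' s' ↦ velocity I (x t') s') (t := t) (s := σ) (hx2 (t, σ))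
    ((hS (t, σ)).of_le h2)
  beta_reduce at hcurv
  have hDσ : covariantDerivAlong cov (x t)
      (fun s' ↦ covariantDerivAlong cov (fun t' ↦ x t' s') (fun t' ↦ velocity I (x t') s') t) σ =
      (covariantDerivAlong cov (fun t' ↦ x t' σ)
          (fun t' ↦ covariantDerivAlong cov (x t') (fun s' ↦ velocity I (x t') s') σ) t :
          TangentSpace I (x t σ)) +
        (cov.curvature (x t σ) (velocity I (x t) σ) (velocity I (fun t' ↦ x t' σ) t)
          (velocity I (x t) σ) : TangentSpace I (x t σ)) := by
    rw [CovariantDerivative.curvature_antisymm, ← hcurv, ← sub_eq_add_neg, sub_sub_cancel]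
  rw [hDσ, ← hsymm, map_add, add_apply] at hprod
  exact hprod

/-- **Pointwise second-order Taylor bound for the energy density of a smooth variation, with
uniform error.** Let `x(t, σ)` be a `C^∞` two-parameter map, `T = ∂_t x`, `S = ∂_σ x`, and put
`f = g(T, T)`, `k = g(D_t S, T)`, `h = g(D_t D_σ S, T) + g(R(S,T)S,T) + g(D_t S, D_t S)` (so that
`∂_σ f = 2k`, `∂_σ k = h`: `hasDerivAt_half_val_velocity`,
`hasDerivAt_val_covariantDerivAlong_velocity_acc`). Then (i) `h` is jointly continuous, and
(ii) for every `a`, `b` and every `ε > 0` there is `δ > 0` such that for all `σ ∈ [0, δ]` and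
`t ∈ [a, b]`, `f(t, σ) ≤ f(t, 0) + σ · 2 k(t, 0) + σ² (h(t, 0) + ε)`. Proof as for
`integral_energy_le_taylor`: `h`, being the `σ`-derivative of the `C^∞` function `k`, is
continuous, hence uniformly continuous on `[a, b] × [0, 1]`, and the defect
`f(σ) − f(0) − 2σ k(0) − σ²(h(0) + ε)` has nonpositive second derivative on `[0, δ]`, zero first
derivative and value at `σ = 0`. This is the quantitative content of the second variation formula
(O'Neill 1983, Ch. 10, Lemma 10.38 / Prop. 10.39; Thm. 10.4) for arbitrary variations.
[cite: ONeill1983, Ch. 10, Lemma 10.38 and Prop. 10.39] -/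
theorem val_velocity_le_taylor (hn : (∞ : ℕ∞ω) ≤ n) {x : ℝ → ℝ → M}
    (hx : ContMDiff (𝓘(ℝ, ℝ).prod 𝓘(ℝ, ℝ)) I ∞ (uncurry x)) (a b : ℝ) :
    Continuous (fun q : ℝ × ℝ ↦
        g.val (x q.1 q.2) (covariantDerivAlong g.leviCivita (fun t' ↦ x t' q.2)
            (fun t' ↦ covariantDerivAlong g.leviCivita (x t') (fun s' ↦ velocity I (x t') s') q.2) q.1)
            (velocity I (fun t' ↦ x t' q.2) q.1) +
          g.val (x q.1 q.2) (g.leviCivita.curvature (x q.1 q.2) (velocity I (x q.1) q.2)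
            (velocity I (fun t' ↦ x t' q.2) q.1) (velocity I (x q.1) q.2))
            (velocity I (fun t' ↦ x t' q.2) q.1) +
          g.val (x q.1 q.2) (covariantDerivAlong g.leviCivita (fun t' ↦ x t' q.2)
            (fun t' ↦ velocity I (x t') q.2) q.1)
            (covariantDerivAlong g.leviCivita (fun t' ↦ x t' q.2) (fun t' ↦ velocity I (x t') q.2) q.1)) ∧
      ∀ ε > 0, ∃ δ > 0, ∀ σ ∈ Icc (0 : ℝ) δ, ∀ t ∈ Icc a b,
        g.val (x t σ) (velocity I (fun t' ↦ x t' σ) t) (velocity I (fun t' ↦ x t' σ) t) ≤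
          g.val (x t 0) (velocity I (fun t' ↦ x t' 0) t) (velocity I (fun t' ↦ x t' 0) t) +
            σ * (2 * g.val (x t 0) (covariantDerivAlong g.leviCivita (fun t' ↦ x t' 0)
              (fun t' ↦ velocity I (x t') 0) t) (velocity I (fun t' ↦ x t' 0) t)) +
            σ * σ * ((g.val (x t 0) (covariantDerivAlong g.leviCivita (fun t' ↦ x t' 0)
                (fun t' ↦ covariantDerivAlong g.leviCivita (x t') (fun s' ↦ velocity I (x t') s') 0) t)
                (velocity I (fun t' ↦ x t' 0) t) +
              g.val (x t 0) (g.leviCivita.curvature (x t 0) (velocity I (x t) 0)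
                (velocity I (fun t' ↦ x t' 0) t) (velocity I (x t) 0)) (velocity I (fun t' ↦ x t' 0) t) +
              g.val (x t 0) (covariantDerivAlong g.leviCivita (fun t' ↦ x t' 0)
                (fun t' ↦ velocity I (x t') 0) t)
                (covariantDerivAlong g.leviCivita (fun t' ↦ x t' 0) (fun t' ↦ velocity I (x t') 0) t)) +
              ε) := by
  haveI : Fact (1 ≤ n) := ⟨le_trans (by exact_mod_cast le_top) hn⟩
  set cov := g.leviCivita with hcov_def
  have hcovI : cov.IsLocallyContMDiff ∞ :=
    g.isLocallyContMDiff_leviCivita_holds ⊤ (le_trans (by exact_mod_cast le_rfl) hn)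
  -- lifts of `T = x_t`, `S = x_σ`, `D_t S`, `D_σ S`, `D_t D_σ S`
  have hT : ContMDiff (𝓘(ℝ, ℝ).prod 𝓘(ℝ, ℝ)) I.tangent ∞ (fun q : ℝ × ℝ ↦
      (TotalSpace.mk' E (x q.1 q.2) (velocity I (fun t' ↦ x t' q.2) q.1) : TangentBundle I M)) :=
    contMDiff_lift_velocity_uncurry_left hx
  have hswap : ContMDiff (𝓘(ℝ, ℝ).prod 𝓘(ℝ, ℝ)) (𝓘(ℝ, ℝ).prod 𝓘(ℝ, ℝ)) ∞
      (fun q : ℝ × ℝ ↦ ((q.2, q.1) : ℝ × ℝ)) := contMDiff_snd.prodMk contMDiff_fst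
  have hS : ContMDiff (𝓘(ℝ, ℝ).prod 𝓘(ℝ, ℝ)) I.tangent ∞ (fun q : ℝ × ℝ ↦
      (TotalSpace.mk' E (x q.1 q.2) (velocity I (x q.1) q.2) : TangentBundle I M)) := by
    have hx' : ContMDiff (𝓘(ℝ, ℝ).prod 𝓘(ℝ, ℝ)) I ∞ (uncurry fun s t ↦ x t s) := hx.comp hswap
    exact (contMDiff_lift_velocity_uncurry_left hx').comp hswap
  have hDtS : ContMDiff (𝓘(ℝ, ℝ).prod 𝓘(ℝ, ℝ)) I.tangent ∞ (fun q : ℝ × ℝ ↦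
      (TotalSpace.mk' E (x q.1 q.2) (covariantDerivAlong cov (fun t' ↦ x t' q.2)
        (fun t' ↦ velocity I (x t') q.2) q.1) : TangentBundle I M)) :=
    contMDiff_lift_covariantDerivAlong_curry_left (cov := cov) hcovI (x := x)
      (Z := fun t s ↦ velocity I (x t) s) hx hS
  have hDσS : ContMDiff (𝓘(ℝ, ℝ).prod 𝓘(ℝ, ℝ)) I.tangent ∞
      (fun q : ℝ × ℝ ↦ (TotalSpace.mk' E (x q.1 q.2)
        (covariantDerivAlong cov (x q.1) (fun s' ↦ velocity I (x q.1) s') q.2) :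
          TangentBundle I M)) :=
    contMDiff_lift_covariantDerivAlong_curry_right (cov := cov) hcovI (x := x)
      (Z := fun t s ↦ velocity I (x t) s) hx hS
  have hDtDσS : ContMDiff (𝓘(ℝ, ℝ).prod 𝓘(ℝ, ℝ)) I.tangent ∞
      (fun q : ℝ × ℝ ↦ (TotalSpace.mk' E (x q.1 q.2)
        (covariantDerivAlong cov (fun t' ↦ x t' q.2)
          (fun t' ↦ covariantDerivAlong cov (x t') (fun s' ↦ velocity I (x t') s') q.2) q.1) :
          TangentBundle I M)) :=
    contMDiff_lift_covariantDerivAlong_curry_left (cov := cov) hcovI (x := x)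
      (Z := fun t s ↦ covariantDerivAlong cov (x t) (fun s' ↦ velocity I (x t) s') s) hx hDσS
  -- the scalar functions `f = g(T,T)`, `k = g(D_tS, T)`,
  -- `h = g(D_t D_σ S, T) + g(R(S,T)S,T) + |D_tS|²`
  set f : ℝ → ℝ → ℝ := fun t σ ↦ g.val (x t σ) (velocity I (fun t' ↦ x t' σ) t)
    (velocity I (fun t' ↦ x t' σ) t) with hf_def
  set k : ℝ → ℝ → ℝ := fun t σ ↦ g.val (x t σ) (covariantDerivAlong cov (fun t' ↦ x t' σ)
    (fun t' ↦ velocity I (x t') σ) t) (velocity I (fun t' ↦ x t' σ) t) with hk_def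
  set h : ℝ → ℝ → ℝ := fun t σ ↦
    g.val (x t σ) (covariantDerivAlong cov (fun t' ↦ x t' σ)
        (fun t' ↦ covariantDerivAlong cov (x t') (fun s' ↦ velocity I (x t') s') σ) t)
        (velocity I (fun t' ↦ x t' σ) t) +
      g.val (x t σ) (cov.curvature (x t σ) (velocity I (x t) σ)
        (velocity I (fun t' ↦ x t' σ) t) (velocity I (x t) σ)) (velocity I (fun t' ↦ x t' σ) t) +
      g.val (x t σ) (covariantDerivAlong cov (fun t' ↦ x t' σ) (fun t' ↦ velocity I (x t') σ) t)
        (covariantDerivAlong cov (fun t' ↦ x t' σ) (fun t' ↦ velocity I (x t') σ) t) with hh_def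
  have hfS : ContMDiff (𝓘(ℝ, ℝ).prod 𝓘(ℝ, ℝ)) 𝓘(ℝ, ℝ) ∞ (fun q : ℝ × ℝ ↦ f q.1 q.2) :=
    fun q ↦ contMDiffAt_val_apply_along g hn (hT q) (hT q)
  have hkS : ContMDiff (𝓘(ℝ, ℝ).prod 𝓘(ℝ, ℝ)) 𝓘(ℝ, ℝ) ∞ (fun q : ℝ × ℝ ↦ k q.1 q.2) :=
    fun q ↦ contMDiffAt_val_apply_along g hn (hDtS q) (hT q)
  have hkC : ContDiff ℝ ∞ (fun q : ℝ × ℝ ↦ k q.1 q.2) := by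
    have h1 : ContMDiff 𝓘(ℝ, ℝ × ℝ) 𝓘(ℝ, ℝ) ∞ (fun q : ℝ × ℝ ↦ k q.1 q.2) := by
      rw [modelWithCornersSelf_prod, ← chartedSpaceSelf_prod]
      exact hkS
    exact contMDiff_iff_contDiff.1 h1
  -- the `σ`-derivatives
  have hfd : ∀ t σ, HasDerivAt (fun σ' ↦ f t σ') (2 * k t σ) σ := by
    intro t σ
    have h1 := (hasDerivAt_half_val_velocity g hn hx t σ).const_mul (2 : ℝ)
    refine h1.congr_of_eventuallyEq (Eventually.of_forall fun σ' ↦ ?_)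
    show f t σ' = 2 * ((1 / 2 : ℝ) * f t σ')
    ring
  have hkd : ∀ t σ, HasDerivAt (fun σ' ↦ k t σ') (h t σ) σ := fun t σ ↦
    hasDerivAt_val_covariantDerivAlong_velocity_acc g hn hx t σ
  -- `h` is a partial derivative of the smooth `k`, hence continuous
  have hkf : ∀ t σ, HasDerivAt (fun σ' ↦ k t σ')
      (fderiv ℝ (fun q : ℝ × ℝ ↦ k q.1 q.2) (t, σ) ((0 : ℝ), (1 : ℝ))) σ := by
    intro t σ
    have hl : HasDerivAt (fun σ' : ℝ ↦ ((t, σ') : ℝ × ℝ)) ((0 : ℝ), (1 : ℝ)) σ :=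
      (hasDerivAt_const σ t).prodMk (hasDerivAt_id' σ)
    exact ((hkC.differentiable (by simp) (t, σ)).hasFDerivAt).comp_hasDerivAt σ hl
  have hh_eq : ∀ t σ, h t σ = fderiv ℝ (fun q : ℝ × ℝ ↦ k q.1 q.2) (t, σ) ((0 : ℝ), (1 : ℝ)) :=
    fun t σ ↦ (hkd t σ).unique (hkf t σ)
  have hhc : Continuous (fun q : ℝ × ℝ ↦ h q.1 q.2) := by
    have h1 : Continuous (fun q : ℝ × ℝ ↦
        fderiv ℝ (fun q : ℝ × ℝ ↦ k q.1 q.2) q ((0 : ℝ), (1 : ℝ))) :=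
      (hkC.continuous_fderiv (by simp)).clm_apply continuous_const
    exact h1.congr fun q ↦ (hh_eq q.1 q.2).symm
  refine ⟨hhc, ?_⟩
  intro ε hε
  -- uniform continuity of `h` on `[a, b] × [0, 1]`
  obtain ⟨δ, hδ, hU⟩ := Metric.uniformContinuousOn_iff.1
    ((isCompact_Icc.prod isCompact_Icc : IsCompact (Icc a b ×ˢ Icc (0 : ℝ) 1)).uniformContinuousOn_of_continuous
      hhc.continuousOn) ε hε
  set δ₀ : ℝ := min (δ / 2) 1 with hδ₀_def
  have hδ₀ : 0 < δ₀ := lt_min (by linarith) one_pos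
  have hδ₀δ : δ₀ < δ := lt_of_le_of_lt (min_le_left _ _) (by linarith)
  have hδ₀1 : δ₀ ≤ 1 := min_le_right _ _
  refine ⟨δ₀, hδ₀, fun σ hσ t ht ↦ ?_⟩
  have hclose : ∀ ξ ∈ Icc (0 : ℝ) δ₀, h t ξ ≤ h t 0 + ε := by
    intro ξ hξ
    have hξ1 : ξ ∈ Icc (0 : ℝ) 1 := ⟨hξ.1, hξ.2.trans hδ₀1⟩
    have h0mem : (0 : ℝ) ∈ Icc (0 : ℝ) 1 := ⟨le_rfl, zero_le_one⟩
    have hdist : dist ((t, ξ) : ℝ × ℝ) (t, 0) < δ := by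
      rw [Prod.dist_eq, dist_self, Real.dist_eq, sub_zero, abs_of_nonneg hξ.1, max_eq_right hξ.1]
      exact lt_of_le_of_lt hξ.2 hδ₀δ
    have h1 := hU (t, ξ) ⟨ht, hξ1⟩ (t, 0) ⟨ht, h0mem⟩ hdist
    rw [Real.dist_eq] at h1
    linarith [(abs_sub_lt_iff.1 h1).1]
  -- the first derivative of the defect is nonpositive
  have hψd : ∀ ξ, HasDerivAt (fun ξ ↦ 2 * k t ξ - ξ * (2 * (h t 0 + ε)) - 2 * k t 0)
      (2 * h t ξ - 2 * (h t 0 + ε)) ξ := fun ξ ↦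
    (((hkd t ξ).const_mul 2).sub (hasDerivAt_mul_const _)).sub_const _
  have hψanti : AntitoneOn (fun ξ ↦ 2 * k t ξ - ξ * (2 * (h t 0 + ε)) - 2 * k t 0) (Icc 0 δ₀) := by
    refine antitoneOn_of_deriv_nonpos (convex_Icc 0 δ₀)
      (HasDerivAt.continuousOn fun ξ _ ↦ hψd ξ)
      (fun ξ _ ↦ (hψd ξ).differentiableAt.differentiableWithinAt) ?_
    intro ξ hξ
    rw [interior_Icc] at hξ
    rw [(hψd ξ).deriv]
    have := hclose ξ ⟨hξ.1.le, hξ.2.le⟩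
    linarith
  have hψle : ∀ ξ ∈ Icc (0 : ℝ) δ₀, 2 * k t ξ - ξ * (2 * (h t 0 + ε)) - 2 * k t 0 ≤ 0 := by
    intro ξ hξ
    have h0 := hψanti ⟨le_rfl, hδ₀.le⟩ hξ hξ.1
    have h00 : (2 * k t 0 - 0 * (2 * (h t 0 + ε)) - 2 * k t 0 : ℝ) = 0 := by ring
    linarith
  -- hence the defect is nonincreasing on `[0, δ₀]` and vanishes at `0`
  have hφd : ∀ ξ, HasDerivAt (fun ξ ↦ f t ξ - ξ * (2 * k t 0) - ξ * ξ * (h t 0 + ε) - f t 0)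
      (2 * k t ξ - 2 * k t 0 - (1 * ξ + ξ * 1) * (h t 0 + ε)) ξ := fun ξ ↦
    (((hfd t ξ).sub (hasDerivAt_mul_const _)).sub
      (((hasDerivAt_id' ξ).mul (hasDerivAt_id' ξ)).mul_const _)).sub_const _
  have hφanti : AntitoneOn (fun ξ ↦ f t ξ - ξ * (2 * k t 0) - ξ * ξ * (h t 0 + ε) - f t 0)
      (Icc 0 δ₀) := by
    refine antitoneOn_of_deriv_nonpos (convex_Icc 0 δ₀)
      (HasDerivAt.continuousOn fun ξ _ ↦ hφd ξ)
      (fun ξ _ ↦ (hφd ξ).differentiableAt.differentiableWithinAt) ?_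
    intro ξ hξ
    rw [interior_Icc] at hξ
    rw [(hφd ξ).deriv]
    have h1 := hψle ξ ⟨hξ.1.le, hξ.2.le⟩
    have h2 : (1 * ξ + ξ * 1) * (h t 0 + ε) = ξ * (2 * (h t 0 + ε)) := by ring
    linarith
  have h1 := hφanti ⟨le_rfl, hδ₀.le⟩ hσ hσ.1
  have h00 : (f t 0 - 0 * (2 * k t 0) - 0 * 0 * (h t 0 + ε) - f t 0 : ℝ) = 0 := by ring
  show f t σ ≤ f t 0 + σ * (2 * k t 0) + σ * σ * (h t 0 + ε)
  linarith

end Literature.Geometry.Riemannian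

end
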